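import Literature.MathematicalPhysics.QuantumFieldTheory.Balaban1983to89.Node00.BetaInputIntegrable
import Literature.MathematicalPhysics.QuantumFieldTheory.Balaban1983to89.Node00.BackgroundSelOfRecord

/-!
# NODE 00 — THE OFFER, β-LAYER HALF: the critical configuration (2.3) and the (2.9) cut-off `χ_k` READ THROUGH `UkSel` — `critCfgSelOfRecord`, `chiFix29SelOfRecord`,
# `chiFixed29Sel` — MEASURABLE UNCONDITIONALLY, lift-COVARIANT ∕ -INVARIANT on the [B11] domain, and the (0.19) β-inputs over them INTEGRABLE ∕ `IsRT` WITH NO HYPOTHESIS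

Cell `pub-ymgap` (YM-PLAN Track A), seat `pub-ymgap-dag-n09-w4` (g2; D-0149 width seat of node N09), FILE 5; helper of K1⁷ `StabilityBAtRecordR13SepCoPH` =
stmt-QuantumFields-20542 (count-neutral).  [I] = [Balaban1987RG1] (CMP 109), [B11] = [Balaban1985Variational] (CMP 102), [III] = [Balaban1988Convergent] (CMP 119).
APPEND-ONLY growth: a NEW importing module over node00-def-K0e's `Node00/SmallFieldChi29OfRecord` ∕ `Node00/BetaInputIntegrable` (the record's `critCfgOfRecord`, `fluctDevOfRecord`,
`chiFix29OfRecord`, `chiFixed29`, `IsB0`, `betaInputOfRecord`, `integrable_betaInput_TcanOfRecord`, `isRT_TcanOfRecord_betaInput` — cited BY NAME, nothing edited) and this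
seat's FILE 3 `Node00/BackgroundSelOfRecord` (`UkSel`).  node00-def-K0c's OFFER pattern: the record's objects are UNTOUCHED; these are the drop-ins priced.

WHY.  K0e's FILE 7 (`BetaInputIntegrable` §3) located the COST of the C4 species: with the β-slot χ = the (2.9) cut-off `chiFixed29 ν ε₁` built on node00-def-B's bare-choice
background `Uk`, the `Integrable` ∕ `IsRT` faces of the (0.19) β-inputs are CONDITIONAL on (H-U) `hU : ∀ k, Measurable (Uk F N K (k+1) ν.εreg)` — unprovable by design; and
dag-n24-c ∕ dag-n09-w2's junctions display, for the same reason, (I19) `hint` and (M1′)∕(181)ˢᵒˡ `hcov`.  FILE 3 offered `UkSel` (measurable; (181)-covariant on the [B11]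
domain).  THIS FILE is K0e's §1–§3 RE-RUN ON `UkSel` — the other half of the adoption kit:
* §1 `critCfgSelOfRecord ν K k W := M^k(UkSel_{k+1} W)` — (2.3) read through the offer: ★ `measurable_critCfgSelOfRecord` (NO hypothesis), `avg_critCfgSelOfRecord` (in the
  fibre over `W` on the solvable set), ★ `critCfgSelOfRecord_gaugeAct` (block-lift COVARIANT at every solvable `W` with unique minimal orbit over `W^v` — the junction's
  `hcov` for the offer, FILE 3 `iter_UkSel_gaugeAct_liftTransf`).
* §2 `fluctDevSelOfRecord`, ★ `chiFix29SelOfRecord ν ε₁ K k` ((2.9) AS PRINTED, `b₀(c)` excluded — K0e's `IsB0`), `chiFix29AllSelOfRecord`; faces (`…_eq_zero_or_one`, `…_mem_Icc`,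
  `…_eq_one_iff`); ★★ `measurable_chiFix29SelOfRecord` ∕ `measurable_chiFix29AllSelOfRecord` — UNCONDITIONAL (K0e's proof with `hU` discharged by `measurable_UkSel`);
  ★ `chiFix29SelOfRecord_gaugeAct_liftTransf` — (M1) AT EVERY FIELD WHOSE AVERAGE IS SOLVABLE WITH UNIQUE ORBITS: `χ^{(2.9),Sel}_k(V^{v∘B}) = χ^{(2.9),Sel}_k(V)` (conjugation
  invariance of `dist1`, dag-n09-w2's one-field argument, fed by §1).
* §4 (v1.1, append-only) the THRESHOLD HIERARCHY twins `mem_domAltOfRecord_of_chiFix29AllSel_eq_one` ∕ `chiFixAltOfRecord_eq_one_of_chiFix29AllSel_eq_one` ∕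
  `chiFixAltOfRecord_mul_chiFix29AllSel` ∕ `mem_domAltOfRecord_of_chiFix29Sel_eq_one` (K0e's §3 with `critCfgOfRecord ↦ critCfgSelOfRecord`; `hcrit` displayed).
* §3 the β-slot keying `chiFixed29Sel ν ε₁` (same TYPE as `chiFixed29` ∕ `chiFixed7`): ★★ `integrable_betaInput_TcanOfRecord_chi29Sel` (`k ≤ K`) and ★★
  `isRT_TcanOfRecord_betaInput_chi29Sel` (`k < K`) — K0e's §3 WITH THE HYPOTHESIS `hU` GONE; `betaInput_TcanOfRecord_chi29Sel_ae_eq`.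

LOCATED READING (for K0e ∕ def-T ∕ plan; NOT this seat's to re-point).  With the record editions `Uk ↦ UkSel` (def-B) and `chiβ ↦ chiFixed29Sel` (def-T's `Record13` β-slot), the
three selection-flavoured binders of N09's Theorem-3 member become theorems: (H-U) ↦ `measurable_UkSel`, (I19) ↦ `integrable_betaInput_TcanOfRecord_chi29Sel`, (M1)∕(M1′) ↦
§1∕§2 ON THE [B11] DOMAIN (off the solvable set no junk-default selector is covariant — dag-n09-w2's obstruction; the on-domain junctions p591459 ∕ p593803 are the consumers).
`chiFix29SelOfRecord` and `chiFix29OfRecord` are DIFFERENT functions in general (they read `V^{(k)}` in different residual gauges) — no comparison is claimed; print's (2.9)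
is the one in the axial gauge of (2.3), i.e. a gauge-FIXED reading like the offer's.

HONEST FRAMING — what this is NOT.  Kernel bookkeeping (K0e's measurability ∕ domination arguments re-run by name; `dist1` conjugation invariance); NOTHING of Bałaban's asserted
([B11] Thm 1 only as the hypotheses `UkExists` ∕ `UniqueUkOrbit`); no estimate; NO carrier of record re-pointed; NOT a discharge of any node; K0⁷ ∕ K1⁷ NOT closed; counts
unmoved (typed 28∕28 · discharged 5∕27); one finite four-torus programme at fixed `ε = L^{−K}` — R4 is the conditional rung `BalabanLadder.UV` only; NOT continuum ∕ ℝ⁴ ∕ OS;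
the YM mass gap (Clay) is NOT proved by any of this.  Definitions (`critCfgSelOfRecord`, `fluctDevSelOfRecord`, `chiFix29SelOfRecord`, `chiFix29AllSelOfRecord`, `chiFixed29Sel`)
+ theorems; 0 `sorry`, 0 `instance`, 0 `notation`.
-/

noncomputable section

open MeasureTheory Set

namespace Literature.MathematicalPhysics.QuantumFieldTheory.Balaban1983to89.Node00

open T4Continuum (T4Family)
open T4TiltOscillation (bdev)
open T4ExpWindowSmallField (plaqDev plaqDev_le_four_mul dist1_plaqHol_le_add)
open B12RTGaugeInvariance254 (LiftInvariant liftTransf avg_gaugeAct_liftTransf)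
open GaugeField (gaugeAct)

variable (F : T4Family) (N : ℕ) [NeZero N]

/-! ## §1  (2.3) read through the offer: `V^{(k),Sel}(W) = M^k(UkSel_{k+1}(W))` -/

/-- **The critical configuration (2.3) READ THROUGH THE OFFER**: `V^{(k),Sel}(W) := M^k(UkSel F N K (k+1) ν.εreg W)` — K0e's `critCfgOfRecord` with `Uk ↦ UkSel`.
[cite: Balaban1987RG1, (2.3) p.265] -/
def critCfgSelOfRecord (ν : Stage7Numerics) (K k : ℕ) (W : GaugeField (F.P K) (k + 1) (SU N)) : GaugeField (F.P K) k (SU N) :=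
  Averaging.iter (avOfRecord F N K) k (UkSel F N K (k + 1) ν.εreg W)

variable {F N}

/-- Unfolding (`rfl`). [cite: Balaban1987RG1, (2.3) p.265 (bookkeeping)] -/
theorem critCfgSelOfRecord_def (ν : Stage7Numerics) (K k : ℕ) (W : GaugeField (F.P K) (k + 1) (SU N)) :
    critCfgSelOfRecord F N ν K k W = Averaging.iter (avOfRecord F N K) k (UkSel F N K (k + 1) ν.εreg W) := rfl

/-- **★ `W ↦ V^{(k),Sel}(W)` IS MEASURABLE — NO HYPOTHESIS** (FILE 3 `measurable_iter_UkSel`; K0e's `measurable_critCfgOfRecord_of` with (H-U) discharged).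
[cite: Balaban1987RG1, (2.3) p.265 (bookkeeping)] -/
theorem measurable_critCfgSelOfRecord (ν : Stage7Numerics) (K k : ℕ) : Measurable (critCfgSelOfRecord F N ν K k) :=
  measurable_iter_UkSel (F := F) (N := N) K (k + 1) ν.εreg k

/-- `V^{(k),Sel}(W)` lies in the fibre over `W` on the solvable set (standing range `k + 1 ≤ m + K`). [cite: Balaban1987RG1, (2.3)–(2.4) pp.265–266] -/
theorem avg_critCfgSelOfRecord {ν : Stage7Numerics} {K k : ℕ} (hk : k + 1 ≤ (F.P K).m + (F.P K).K) {W : GaugeField (F.P K) (k + 1) (SU N)}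
    (h : UkExists F N K (k + 1) ν.εreg W) : (avOfRecord F N K k).avg (critCfgSelOfRecord F N ν K k W) = W :=
  (isBackground_UkSel hk h).1

/-- **★ BLOCK-LIFT COVARIANCE OF `V^{(k),Sel}` ON THE [B11] DOMAIN** — the junction's binder `hcov` FOR THE OFFER: `V^{(k),Sel}(W^v) = (V^{(k),Sel}(W))^{v∘blockOf}` whenever (0.21) is
solvable at `W` and the minimal orbit over `W^v` is unique (FILE 3 `iter_UkSel_gaugeAct_liftTransf`). [cite: Balaban1987RG1, (2.3) p.265; Balaban1985Variational, (181) p.307] -/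
theorem critCfgSelOfRecord_gaugeAct {ν : Stage7Numerics} {K k : ℕ} (hk : k + 1 ≤ (F.P K).m + (F.P K).K) (v : GaugeTransf (F.P K) (k + 1) (SU N))
    {W : GaugeField (F.P K) (k + 1) (SU N)} (hW : UkExists F N K (k + 1) ν.εreg W) (hu : UniqueUkOrbit F N K (k + 1) ν.εreg (gaugeAct v W)) :
    critCfgSelOfRecord F N ν K k (gaugeAct v W) = gaugeAct (liftTransf v) (critCfgSelOfRecord F N ν K k W) :=
  iter_UkSel_gaugeAct_liftTransf hk v hW hu

variable (F N)

/-! ## §2  (2.9) read through the offer: `χ^{(2.9),Sel}_k` -/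

/-- The fluctuation deviation `|V′(b) − 1|` on the fibre, through the offer (K0e's `fluctDevOfRecord` with `Uk ↦ UkSel`). [cite: Balaban1987RG1, (2.1) p.265 and (2.9) p.266] -/
def fluctDevSelOfRecord (ν : Stage7Numerics) (K k : ℕ) (V : GaugeField (F.P K) k (SU N)) (b : PBond (F.P K) k) : ℝ :=
  dist1 (bdev V (critCfgSelOfRecord F N ν K k ((avOfRecord F N K k).avg V)) b)

open Classical in
/-- **`χ^{(2.9),Sel}_k` AS PRINTED** — (2.9) with the distinguished bonds `b₀(c)` excluded (K0e's `IsB0`), through the offer. [cite: Balaban1987RG1, (2.9) p.266] -/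
def chiFix29SelOfRecord (ν : Stage7Numerics) (ε₁ : ℝ) (K k : ℕ) : Density (F.P K) k (SU N) :=
  fun V => if ∀ b : PBond (F.P K) k, ¬ IsB0 b → fluctDevSelOfRecord F N ν K k V b < ε₁ then 1 else 0

open Classical in
/-- The all-bonds twin, through the offer. [cite: Balaban1987RG1, (2.9) p.266] -/
def chiFix29AllSelOfRecord (ν : Stage7Numerics) (ε₁ : ℝ) (K k : ℕ) : Density (F.P K) k (SU N) :=
  fun V => if ∀ b : PBond (F.P K) k, fluctDevSelOfRecord F N ν K k V b < ε₁ then 1 else 0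

variable {F N}

/-- Unfolding (`rfl`). [cite: Balaban1987RG1, (2.9) p.266 (bookkeeping)] -/
theorem fluctDevSelOfRecord_apply (ν : Stage7Numerics) (K k : ℕ) (V : GaugeField (F.P K) k (SU N)) (b : PBond (F.P K) k) :
    fluctDevSelOfRecord F N ν K k V b = dist1 ((critCfgSelOfRecord F N ν K k ((avOfRecord F N K k).avg V) b)⁻¹ * V b) := rfl

/-- `χ^{(2.9),Sel} ∈ {0,1}`. [cite: Balaban1987RG1, (2.9) p.266 (bookkeeping)] -/
theorem chiFix29SelOfRecord_eq_zero_or_one (ν : Stage7Numerics) (ε₁ : ℝ) (K k : ℕ) (V : GaugeField (F.P K) k (SU N)) :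
    chiFix29SelOfRecord F N ν ε₁ K k V = 0 ∨ chiFix29SelOfRecord F N ν ε₁ K k V = 1 := by
  unfold chiFix29SelOfRecord
  split_ifs
  · exact Or.inr rfl
  · exact Or.inl rfl

/-- `χ^{(2.9),Sel,all} ∈ {0,1}`. [cite: Balaban1987RG1, (2.9) p.266 (bookkeeping)] -/
theorem chiFix29AllSelOfRecord_eq_zero_or_one (ν : Stage7Numerics) (ε₁ : ℝ) (K k : ℕ) (V : GaugeField (F.P K) k (SU N)) :
    chiFix29AllSelOfRecord F N ν ε₁ K k V = 0 ∨ chiFix29AllSelOfRecord F N ν ε₁ K k V = 1 := by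
  unfold chiFix29AllSelOfRecord
  split_ifs
  · exact Or.inr rfl
  · exact Or.inl rfl

/-- `χ^{(2.9),Sel} ∈ [0,1]`. [cite: Balaban1987RG1, (2.9) p.266 (bookkeeping)] -/
theorem chiFix29SelOfRecord_mem_Icc (ν : Stage7Numerics) (ε₁ : ℝ) (K k : ℕ) (V : GaugeField (F.P K) k (SU N)) :
    chiFix29SelOfRecord F N ν ε₁ K k V ∈ Icc (0 : ℝ) 1 := by
  rcases chiFix29SelOfRecord_eq_zero_or_one ν ε₁ K k V with h | h <;> rw [h]
  · exact ⟨le_rfl, zero_le_one⟩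
  · exact ⟨zero_le_one, le_rfl⟩

/-- `χ^{(2.9),Sel}_k(V) = 1` iff every non-distinguished fluctuation variable is `ε₁`-small. [cite: Balaban1987RG1, (2.9) p.266] -/
theorem chiFix29SelOfRecord_eq_one_iff (ν : Stage7Numerics) (ε₁ : ℝ) (K k : ℕ) (V : GaugeField (F.P K) k (SU N)) :
    chiFix29SelOfRecord F N ν ε₁ K k V = 1 ↔ ∀ b : PBond (F.P K) k, ¬ IsB0 b → fluctDevSelOfRecord F N ν K k V b < ε₁ := by
  unfold chiFix29SelOfRecord
  split_ifs with h
  · exact ⟨fun _ => h, fun _ => rfl⟩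
  · exact ⟨fun h1 => absurd h1 zero_ne_one, fun h' => absurd h' h⟩

/-- `χ^{(2.9),Sel,all}_k(V) = 1` iff every fluctuation variable is `ε₁`-small. [cite: Balaban1987RG1, (2.9) p.266] -/
theorem chiFix29AllSelOfRecord_eq_one_iff (ν : Stage7Numerics) (ε₁ : ℝ) (K k : ℕ) (V : GaugeField (F.P K) k (SU N)) :
    chiFix29AllSelOfRecord F N ν ε₁ K k V = 1 ↔ ∀ b : PBond (F.P K) k, fluctDevSelOfRecord F N ν K k V b < ε₁ := by
  unfold chiFix29AllSelOfRecord
  split_ifs with h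
  · exact ⟨fun _ => h, fun _ => rfl⟩
  · exact ⟨fun h1 => absurd h1 zero_ne_one, fun h' => absurd h' h⟩

/-- Each fluctuation deviation through the offer is a MEASURABLE function of `V` — no hypothesis. [cite: Balaban1987RG1, (2.9) p.266 (bookkeeping)] -/
theorem measurable_fluctDevSelOfRecord (ν : Stage7Numerics) (K k : ℕ) (b : PBond (F.P K) k) :
    Measurable (fun V : GaugeField (F.P K) k (SU N) => fluctDevSelOfRecord F N ν K k V b) := by
  have hcrit : Measurable (fun V : GaugeField (F.P K) k (SU N) => critCfgSelOfRecord F N ν K k ((avOfRecord F N K k).avg V) b) :=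
    (measurable_pi_apply b).comp ((measurable_critCfgSelOfRecord ν K k).comp (avOfRecord_measurable F N K k))
  have hV : Measurable (fun V : GaugeField (F.P K) k (SU N) => V b) := measurable_pi_apply b
  unfold fluctDevSelOfRecord bdev
  exact RegularGaugeGroup.measurable_dist1.comp (hcrit.inv.mul hV)

/-- **★★ `χ^{(2.9),Sel,all}_k` IS MEASURABLE — UNCONDITIONALLY.** [cite: Balaban1987RG1, (2.9) p.266 (bookkeeping)] -/
theorem measurable_chiFix29AllSelOfRecord (ν : Stage7Numerics) (ε₁ : ℝ) (K k : ℕ) : Measurable (chiFix29AllSelOfRecord F N ν ε₁ K k) := by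
  have hS : MeasurableSet {V : GaugeField (F.P K) k (SU N) | ∀ b : PBond (F.P K) k, fluctDevSelOfRecord F N ν K k V b < ε₁} := by
    have h : {V : GaugeField (F.P K) k (SU N) | ∀ b : PBond (F.P K) k, fluctDevSelOfRecord F N ν K k V b < ε₁} =
        ⋂ b : PBond (F.P K) k, {V | fluctDevSelOfRecord F N ν K k V b < ε₁} := by
      ext V
      simp only [mem_setOf_eq, mem_iInter]
    rw [h]
    exact MeasurableSet.iInter fun b => measurableSet_lt (measurable_fluctDevSelOfRecord ν K k b) measurable_const
  unfold chiFix29AllSelOfRecord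
  exact Measurable.ite hS measurable_const measurable_const

/-- **★★ `χ^{(2.9),Sel}_k` (AS PRINTED) IS MEASURABLE — UNCONDITIONALLY** (K0e's `measurable_chiFix29OfRecord_of` with `hU` discharged by FILE 3 `measurable_UkSel`).
[cite: Balaban1987RG1, (2.9) p.266 (bookkeeping)] -/
theorem measurable_chiFix29SelOfRecord (ν : Stage7Numerics) (ε₁ : ℝ) (K k : ℕ) : Measurable (chiFix29SelOfRecord F N ν ε₁ K k) := by
  classical
  have hS : MeasurableSet {V : GaugeField (F.P K) k (SU N) | ∀ b : PBond (F.P K) k, ¬ IsB0 b → fluctDevSelOfRecord F N ν K k V b < ε₁} := by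
    have h : {V : GaugeField (F.P K) k (SU N) | ∀ b : PBond (F.P K) k, ¬ IsB0 b → fluctDevSelOfRecord F N ν K k V b < ε₁} =
        ⋂ b : PBond (F.P K) k, {V | ¬ IsB0 b → fluctDevSelOfRecord F N ν K k V b < ε₁} := by
      ext V
      simp only [mem_setOf_eq, mem_iInter]
    rw [h]
    refine MeasurableSet.iInter fun b => ?_
    by_cases hb : IsB0 b
    · have : {V : GaugeField (F.P K) k (SU N) | ¬ IsB0 b → fluctDevSelOfRecord F N ν K k V b < ε₁} = univ :=
        eq_univ_of_forall fun V h0 => absurd hb h0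
      rw [this]
      exact MeasurableSet.univ
    · have : {V : GaugeField (F.P K) k (SU N) | ¬ IsB0 b → fluctDevSelOfRecord F N ν K k V b < ε₁} =
          {V | fluctDevSelOfRecord F N ν K k V b < ε₁} := by
        ext V
        simp only [mem_setOf_eq]
        exact ⟨fun h => h hb, fun h _ => h⟩
      rw [this]
      exact measurableSet_lt (measurable_fluctDevSelOfRecord ν K k b) measurable_const
  unfold chiFix29SelOfRecord
  exact Measurable.ite hS measurable_const measurable_const

/-- **EVERY FLUCTUATION VARIABLE IS UNCHANGED UNDER THE LIFT** at a field `V` whose average is solvable with unique minimal orbit over `(V̄)^v` — `dist1` is conjugation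
invariant and `V^{(k),Sel}` is covariant there (§1; dag-n09-w2's one-field argument). [cite: Balaban1987RG1, (2.1) p.265 and (2.3) p.265; Balaban1985Variational, (181) p.307] -/
theorem fluctDevSelOfRecord_gaugeAct_liftTransf {ν : Stage7Numerics} {K k : ℕ} (hk : k + 1 ≤ (F.P K).m + (F.P K).K) (v : GaugeTransf (F.P K) (k + 1) (SU N))
    {V : GaugeField (F.P K) k (SU N)} (hV : UkExists F N K (k + 1) ν.εreg ((avOfRecord F N K k).avg V))
    (hu : UniqueUkOrbit F N K (k + 1) ν.εreg (gaugeAct v ((avOfRecord F N K k).avg V))) (b : PBond (F.P K) k) :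
    fluctDevSelOfRecord F N ν K k (gaugeAct (liftTransf v) V) b = fluctDevSelOfRecord F N ν K k V b := by
  rw [fluctDevSelOfRecord_apply, fluctDevSelOfRecord_apply, avg_gaugeAct_liftTransf hk, critCfgSelOfRecord_gaugeAct hk v hV hu]
  set c := critCfgSelOfRecord F N ν K k ((avOfRecord F N K k).avg V) b
  have h : (gaugeAct (liftTransf v) (critCfgSelOfRecord F N ν K k ((avOfRecord F N K k).avg V)) b)⁻¹ * gaugeAct (liftTransf v) V b =
      liftTransf v b.tgt * (c⁻¹ * V b) * (liftTransf v b.tgt)⁻¹ := by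
    simp only [GaugeField.gaugeAct, c, mul_inv_rev, inv_inv]
    group
  rw [h, GaugeGroup.dist1_conj]

/-- **★ (M1) AT ONE FIELD FOR THE OFFER**: `χ^{(2.9),Sel}_k(V^{v∘blockOf}) = χ^{(2.9),Sel}_k(V)` whenever `V̄` is solvable with unique minimal orbit over `V̄^v` — the cut-off
reads only the profile `b ↦ |V′(b) − 1|`. [cite: Balaban1987RG1, (2.9) p.266; Balaban1985Variational, (181) p.307] -/
theorem chiFix29SelOfRecord_gaugeAct_liftTransf {ν : Stage7Numerics} (ε₁ : ℝ) {K k : ℕ} (hk : k + 1 ≤ (F.P K).m + (F.P K).K)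
    (v : GaugeTransf (F.P K) (k + 1) (SU N)) {V : GaugeField (F.P K) k (SU N)} (hV : UkExists F N K (k + 1) ν.εreg ((avOfRecord F N K k).avg V))
    (hu : UniqueUkOrbit F N K (k + 1) ν.εreg (gaugeAct v ((avOfRecord F N K k).avg V))) :
    chiFix29SelOfRecord F N ν ε₁ K k (gaugeAct (liftTransf v) V) = chiFix29SelOfRecord F N ν ε₁ K k V := by
  have hdev : ∀ b, fluctDevSelOfRecord F N ν K k (gaugeAct (liftTransf v) V) b = fluctDevSelOfRecord F N ν K k V b :=
    fun b => fluctDevSelOfRecord_gaugeAct_liftTransf hk v hV hu b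
  classical
  simp only [chiFix29SelOfRecord, hdev]

/-- The all-bonds twin of the one-field (M1). [cite: Balaban1987RG1, (2.9) p.266; Balaban1985Variational, (181) p.307] -/
theorem chiFix29AllSelOfRecord_gaugeAct_liftTransf {ν : Stage7Numerics} (ε₁ : ℝ) {K k : ℕ} (hk : k + 1 ≤ (F.P K).m + (F.P K).K)
    (v : GaugeTransf (F.P K) (k + 1) (SU N)) {V : GaugeField (F.P K) k (SU N)} (hV : UkExists F N K (k + 1) ν.εreg ((avOfRecord F N K k).avg V))
    (hu : UniqueUkOrbit F N K (k + 1) ν.εreg (gaugeAct v ((avOfRecord F N K k).avg V))) :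
    chiFix29AllSelOfRecord F N ν ε₁ K k (gaugeAct (liftTransf v) V) = chiFix29AllSelOfRecord F N ν ε₁ K k V := by
  have hdev : ∀ b, fluctDevSelOfRecord F N ν K k (gaugeAct (liftTransf v) V) b = fluctDevSelOfRecord F N ν K k V b :=
    fun b => fluctDevSelOfRecord_gaugeAct_liftTransf hk v hV hu b
  classical
  simp only [chiFix29AllSelOfRecord, hdev]

/-- **(M1) ON A SET for the offer**: if at radius `ν.εreg`, level `k+1`, every SOLVABLE coarse field has a unique minimal orbit ([B11] Thm 1 — DISPLAYED), then `χ^{(2.9),Sel}_k` is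
lift-invariant at every `V` whose average is solvable (= p591459's `hχinv`-on-the-solvable-set shape for the offer, no covariance hypothesis left).
[cite: Balaban1987RG1, (2.9) p.266; Balaban1985Variational, Thm 1 p.279 and (181) p.307] -/
theorem chiFix29SelOfRecord_liftInvariantOn_solvable {ν : Stage7Numerics} (ε₁ : ℝ) {K k : ℕ} (hk : k + 1 ≤ (F.P K).m + (F.P K).K)
    (hsolU : ∀ W : GaugeField (F.P K) (k + 1) (SU N), UkExists F N K (k + 1) ν.εreg W → UniqueUkOrbit F N K (k + 1) ν.εreg W) :
    ∀ (v : GaugeTransf (F.P K) (k + 1) (SU N)) (V : GaugeField (F.P K) k (SU N)), UkExists F N K (k + 1) ν.εreg ((avOfRecord F N K k).avg V) →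
      chiFix29SelOfRecord F N ν ε₁ K k (gaugeAct (liftTransf v) V) = chiFix29SelOfRecord F N ν ε₁ K k V :=
  fun v _ hV => chiFix29SelOfRecord_gaugeAct_liftTransf ε₁ hk v hV (hsolU _ ((ukExists_gaugeAct_iff' hk v _).2 hV))

variable (F N)

/-! ## §3  The β-slot keying and the (0.19) β-inputs over the offer: integrable and `IsRT` WITH NO HYPOTHESIS -/

/-- **THE (2.9)-KEYED β-SLOT χ THROUGH THE OFFER** `chiFixed29Sel ν ε₁ : (K : ℕ) → (ℕ → ℝ) → (k : ℕ) → Density (F.P K) k (SU N)` — same TYPE as K0e's `chiFixed29` (and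
`chiFixed7`), coupling-blind; the drop-in for def-T's β-slot. [cite: Balaban1987RG1, (0.19) p.256 and (2.9) p.266] -/
def chiFixed29Sel (ν : Stage7Numerics) (ε₁ : ℝ) : (K : ℕ) → (ℕ → ℝ) → (k : ℕ) → Density (F.P K) k (SU N) :=
  fun K _ k => chiFix29SelOfRecord F N ν ε₁ K k

variable {F N}

/-- Unfolding at a run (`rfl`). [cite: Balaban1987RG1, (2.9) p.266 (bookkeeping)] -/
theorem chiFixed29Sel_apply (ν : Stage7Numerics) (ε₁ : ℝ) (K : ℕ) (g : ℕ → ℝ) (k : ℕ) : chiFixed29Sel F N ν ε₁ K g k = chiFix29SelOfRecord F N ν ε₁ K k := rfl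

/-- `0 ≤ χ`. [cite: Balaban1987RG1, (2.9) p.266 (bookkeeping)] -/
theorem chiFixed29Sel_nonneg (ν : Stage7Numerics) (ε₁ : ℝ) (K : ℕ) (g : ℕ → ℝ) (k : ℕ) (V : GaugeField (F.P K) k (SU N)) :
    0 ≤ chiFixed29Sel F N ν ε₁ K g k V :=
  (chiFix29SelOfRecord_mem_Icc ν ε₁ K k V).1

/-- `χ ≤ 1`. [cite: Balaban1987RG1, (2.9) p.266 (bookkeeping)] -/
theorem chiFixed29Sel_le_one (ν : Stage7Numerics) (ε₁ : ℝ) (K : ℕ) (g : ℕ → ℝ) (k : ℕ) (V : GaugeField (F.P K) k (SU N)) :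
    chiFixed29Sel F N ν ε₁ K g k V ≤ 1 :=
  (chiFix29SelOfRecord_mem_Icc ν ε₁ K k V).2

/-- **★ The (2.9)-keyed β-slot χ through the offer is MEASURABLE at every run and step — NO HYPOTHESIS** (K0e's `measurable_chiFixed29_of` minus `hU`).
[cite: Balaban1987RG1, (2.9) p.266 (bookkeeping)] -/
theorem measurable_chiFixed29Sel (ν : Stage7Numerics) (ε₁ : ℝ) (K : ℕ) (g : ℕ → ℝ) (k : ℕ) : Measurable (chiFixed29Sel F N ν ε₁ K g k) :=
  measurable_chiFix29SelOfRecord ν ε₁ K k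

/-- **★★ (I19) AS A THEOREM FOR THE OFFER: every (0.19) β-input over `TcanOfRecord` with the β-slot `chiFixed29Sel` is INTEGRABLE**, `k ≤ K` — K0e's
`integrable_betaInput_TcanOfRecord_chi29` WITH ITS HYPOTHESIS `hU` GONE. [cite: Balaban1987RG1, (0.19) p.255 and (2.9) p.266] -/
theorem integrable_betaInput_TcanOfRecord_chi29Sel (ν : Stage7Numerics) (ε₁ : ℝ) (K : ℕ) (g : ℕ → ℝ) {k : ℕ} (hk : k ≤ K) :
    Integrable (betaInputOfRecord F N (TcanOfRecord F N) (chiFixed29Sel F N ν ε₁) K g k) (fieldMeasure (F.P K) k (SU N)) :=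
  integrable_betaInput_TcanOfRecord (chiFixed29Sel F N ν ε₁) K g (fun k => measurable_chiFixed29Sel ν ε₁ K g k)
    (fun k U => chiFixed29Sel_nonneg ν ε₁ K g k U) (fun k U => chiFixed29Sel_le_one ν ε₁ K g k U) hk

/-- **★★ THE `IsRT` FACE FOR THE OFFER — NO HYPOTHESIS**: at every β-input, `k < K`, its image under `TcanOfRecord` IS a renormalisation transformation of it (K0e's
`isRT_TcanOfRecord_betaInput_chi29` minus `hU`). [cite: Balaban1985Averaging, (10) p.19; Balaban1987RG1, (0.19) p.255 and (2.9) p.266] -/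
theorem isRT_TcanOfRecord_betaInput_chi29Sel (ν : Stage7Numerics) (ε₁ : ℝ) (K : ℕ) (g : ℕ → ℝ) {k : ℕ} (hk : k < K) :
    IsRT (avOfRecord F N K k).avg (betaInputOfRecord F N (TcanOfRecord F N) (chiFixed29Sel F N ν ε₁) K g k)
      (TcanOfRecord F N K k (betaInputOfRecord F N (TcanOfRecord F N) (chiFixed29Sel F N ν ε₁) K g k)) :=
  isRT_TcanOfRecord_betaInput (chiFixed29Sel F N ν ε₁) K g (fun k => measurable_chiFixed29Sel ν ε₁ K g k)
    (fun k U => chiFixed29Sel_nonneg ν ε₁ K g k U) (fun k U => chiFixed29Sel_le_one ν ε₁ K g k U) hk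

/-- … and the image is a version of the kernel transform (no hypothesis). [cite: Balaban1988Convergent, (3.1) p.264 (bookkeeping)] -/
theorem betaInput_TcanOfRecord_chi29Sel_ae_eq (ν : Stage7Numerics) (ε₁ : ℝ) (K : ℕ) (g : ℕ → ℝ) (k : ℕ) :
    (fun V : PBond (F.P K) (k + 1) → SU N => TcanOfRecord F N K k (betaInputOfRecord F N (TcanOfRecord F N) (chiFixed29Sel F N ν ε₁) K g k) V)
      =ᵐ[piHaar (F.P K) (k + 1) (SU N)] fun V => transportOfRecord F N K k (betaInputOfRecord F N (TcanOfRecord F N) (chiFixed29Sel F N ν ε₁) K g k) V :=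
  betaInput_TcanOfRecord_ae_eq _ K g k

/-- **★ LIFT-INVARIANCE OF THE β-SLOT χ ON THE SOLVABLE SET, run-indexed** (p591459's `hχinv`∕`hcov` consumer shape for the offer): under «uniqueness wherever solvable» at the
steps `j < K`, `chiFixed29Sel ν ε₁ K g j` is lift-invariant at every field with solvable average. [cite: Balaban1987RG1, (2.9) p.266; Balaban1985Variational, Thm 1 p.279 and (181) p.307] -/
theorem chiFixed29Sel_liftInvariantOn_solvable (ν : Stage7Numerics) (ε₁ : ℝ) (K : ℕ) (g : ℕ → ℝ)
    (hsolU : ∀ j < K, ∀ W : GaugeField (F.P K) (j + 1) (SU N), UkExists F N K (j + 1) ν.εreg W → UniqueUkOrbit F N K (j + 1) ν.εreg W) :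
    ∀ j < K, ∀ (v : GaugeTransf (F.P K) (j + 1) (SU N)) (V : GaugeField (F.P K) j (SU N)), UkExists F N K (j + 1) ν.εreg ((avOfRecord F N K j).avg V) →
      chiFixed29Sel F N ν ε₁ K g j (gaugeAct (liftTransf v) V) = chiFixed29Sel F N ν ε₁ K g j V := by
  intro j hj v V hV
  have hj' : j + 1 ≤ (F.P K).m + (F.P K).K := by simp only [T4Continuum.T4Family.P_K]; omega
  exact chiFix29SelOfRecord_liftInvariantOn_solvable ε₁ hj' (hsolU j hj) v V hV

/-! ## §4  (v1.1, append-only) THE THRESHOLD HIERARCHY for the offer: on the support of `χ^{(2.9),Sel}` the sharp domain indicator of record is `1`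
(K0e's §3 lemmas with `critCfgOfRecord ↦ critCfgSelOfRecord`; the Prop-2 [12] smallness of `V^{(k),Sel}(V̄)` is a HYPOTHESIS `hcrit`, never asserted) -/

/-- **THRESHOLD-HIERARCHY LEMMA (all-bonds form) for the offer**: if every fluctuation variable of `V` (read against `V^{(k),Sel}`) is `ε₁`-small, the critical configuration
`V^{(k),Sel}(V̄)` has `δ`-small plaquettes and `δ + 4ε₁ ≤ ε₀`, then `V ∈ domAltOfRecord ν K k` (the tree's `dist1_plaqHol_le_add` + `plaqDev_le_four_mul`).
[cite: Balaban1988Convergent, p.265; Balaban1989LargeFieldI, Prop. 1 (1.78) p.194] -/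
theorem mem_domAltOfRecord_of_chiFix29AllSel_eq_one {ν : Stage7Numerics} {ε₁ δ : ℝ} {K k : ℕ} {V : GaugeField (F.P K) k (SU N)}
    (hχ : chiFix29AllSelOfRecord F N ν ε₁ K k V = 1)
    (hcrit : PlaqSmall δ (critCfgSelOfRecord F N ν K k ((avOfRecord F N K k).avg V)))
    (hord : δ + 4 * ε₁ ≤ ν.ε₀) : V ∈ domAltOfRecord F N ν K k := by
  rw [mem_domAltOfRecord_iff]
  intro p
  set V₀ := critCfgSelOfRecord F N ν K k ((avOfRecord F N K k).avg V)
  have hb : ∀ b, dist1 (bdev V V₀ b) ≤ ε₁ := fun b => le_of_lt ((chiFix29AllSelOfRecord_eq_one_iff ν ε₁ K k V).1 hχ b)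
  calc dist1 (GaugeField.plaqHol V p) ≤ dist1 (GaugeField.plaqHol V₀ p) + plaqDev V V₀ p := dist1_plaqHol_le_add V V₀ p
    _ < δ + 4 * ε₁ := add_lt_add_of_lt_of_le (hcrit p) (plaqDev_le_four_mul hb p)
    _ ≤ ν.ε₀ := hord

/-- Hence the sharp domain indicator of record is `1` there: `chiFixAltOfRecord ν K k V = 1`. [cite: Balaban1988Convergent, p.265] -/
theorem chiFixAltOfRecord_eq_one_of_chiFix29AllSel_eq_one {ν : Stage7Numerics} {ε₁ δ : ℝ} {K k : ℕ} {V : GaugeField (F.P K) k (SU N)}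
    (hχ : chiFix29AllSelOfRecord F N ν ε₁ K k V = 1)
    (hcrit : PlaqSmall δ (critCfgSelOfRecord F N ν K k ((avOfRecord F N K k).avg V)))
    (hord : δ + 4 * ε₁ ≤ ν.ε₀) : chiFixAltOfRecord F N ν K k V = 1 :=
  (chiFixAltOfRecord_eq_one_iff_mem ν K k V).2 (mem_domAltOfRecord_of_chiFix29AllSel_eq_one hχ hcrit hord)

/-- **PRODUCT FORM for the offer**: `χ^{dom}_k(V) · χ^{(2.9),Sel,all}_k(V) = χ^{(2.9),Sel,all}_k(V)` under the displayed smallness of the critical configuration and the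
threshold ordering. [cite: Balaban1988Convergent, pp.265–269] -/
theorem chiFixAltOfRecord_mul_chiFix29AllSel {ν : Stage7Numerics} {ε₁ δ : ℝ} {K k : ℕ} (V : GaugeField (F.P K) k (SU N))
    (hcrit : PlaqSmall δ (critCfgSelOfRecord F N ν K k ((avOfRecord F N K k).avg V)))
    (hord : δ + 4 * ε₁ ≤ ν.ε₀) :
    chiFixAltOfRecord F N ν K k V * chiFix29AllSelOfRecord F N ν ε₁ K k V = chiFix29AllSelOfRecord F N ν ε₁ K k V := by
  rcases chiFix29AllSelOfRecord_eq_zero_or_one ν ε₁ K k V with h | h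
  · rw [h, mul_zero]
  · rw [h, mul_one, chiFixAltOfRecord_eq_one_of_chiFix29AllSel_eq_one h hcrit hord]

/-- **PRINTED FORM, MODULO THE p. 266–267 RIDER, for the offer**: with (2.9) as printed the same conclusion holds once the excluded `b₀(c)`-variables obey the induced
restriction (displayed `hb0`) and `δ + 4·max(ε₁, ε₁′) ≤ ε₀`. [cite: Balaban1987RG1, (2.9) p.266 and p.267] -/
theorem mem_domAltOfRecord_of_chiFix29Sel_eq_one {ν : Stage7Numerics} {ε₁ ε₁' δ : ℝ} {K k : ℕ} {V : GaugeField (F.P K) k (SU N)}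
    (hχ : chiFix29SelOfRecord F N ν ε₁ K k V = 1)
    (hb0 : ∀ b : PBond (F.P K) k, IsB0 b → fluctDevSelOfRecord F N ν K k V b ≤ ε₁')
    (hcrit : PlaqSmall δ (critCfgSelOfRecord F N ν K k ((avOfRecord F N K k).avg V)))
    (hord : δ + 4 * max ε₁ ε₁' ≤ ν.ε₀) : V ∈ domAltOfRecord F N ν K k := by
  rw [mem_domAltOfRecord_iff]
  intro p
  set V₀ := critCfgSelOfRecord F N ν K k ((avOfRecord F N K k).avg V)
  have hb : ∀ b, dist1 (bdev V V₀ b) ≤ max ε₁ ε₁' := by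
    intro b
    by_cases h0 : IsB0 b
    · exact (hb0 b h0).trans (le_max_right _ _)
    · exact (le_of_lt ((chiFix29SelOfRecord_eq_one_iff ν ε₁ K k V).1 hχ b h0)).trans (le_max_left _ _)
  calc dist1 (GaugeField.plaqHol V p) ≤ dist1 (GaugeField.plaqHol V₀ p) + plaqDev V V₀ p := dist1_plaqHol_le_add V V₀ p
    _ < δ + 4 * max ε₁ ε₁' := add_lt_add_of_lt_of_le (hcrit p) (plaqDev_le_four_mul hb p)
    _ ≤ ν.ε₀ := hord

end Literature.MathematicalPhysics.QuantumFieldTheory.Balaban1983to89.Node00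

end
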